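import Summits.QuantumFields.YangMills.Theorems.BalabanUVNodesN19RekeyingAbsorption

/-!
# BalabanUVNodes ∕ node N19 (NE7) — THE RE-KEYING CALCULUS, PART IV (class form): ABSORPTION STATED ON THE CLASS SUMS, OFF THE FLAGGED CLASSES, WITH CLASS-DEPENDENT
# LR MODULI — and its producers: fibrewise factorisation (p610409), a RELATIVELY RARE unflagged perturbation of ANY distortion (cost `log(1 + ε)`), blockwise local factors with
# block-dependent moduli (cost `Σ_b σ_b(τ)`: only the class's own «loud» blocks pay), a causal law through ONE Markov edge (cost = that edge kernel's LR-oscillation)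

Cell `pub-ymgap` (HUMAN RULING D-0062 Track A ∕ D-0149 width seats), WIDTH SEAT `pub-ymgap-dag-n19-w1` (node n19 = NE7, seat 1 of 3), generation g4, INTENT-3.  Route
`Summits/QuantumFields/YangMills/Theses/BalabanUVNodes.lean`, key item K3⁷ `SpineGivenEndpointR13SepCoPH` (stmt-QuantumFields-20544; v5 stub 2 `stub_expansion13H`, conjuncts N19′
`KeyedCoreEdgeHolderD4` ∧ N20 `KeyedRelWeight`); filed `--kind proof --supports … --as helper`.  COUNT-NEUTRAL.  THEOREMS ONLY (0 `def`, 0 `sorry`).  ADDITIVE — imports this seat's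
g4 `…Theorems.BalabanUVNodesN19RekeyingAbsorption` (p610409: `chain_lower`, `chain_upper`; through it g3 `…N19RekeyingAscent.sandwich_sum`, the tree's `Spine/NE7/Targets` (`Core`),
`T4MatchingAssembly` (`HybridNE7`, `hybridNE7_noShell`), `T4WeightBudget` (`RelWeightBound`)) ONLY; modifies nothing.

WHY.  p610409 states absorption with a TERMWISE factorisation on EVERY class and a CLASS-UNIFORM LR modulus.  A window-key proof of N19′ meets three things not of that form:
(1) FLAGGED classes (a pending old region visible in the window — Bałaban's «old AND pending», N20's bad class) where nothing factorises and `RelWeightBound` pays instead;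
(2) rare UNFLAGGED anomalies inside a good class (healed-but-atypical old regions): arbitrary distortion, small relative MASS; (3) locality with a CLASS-DEPENDENT bill: per block the
LR-coupling of the window's first level to the old structure is tiny on the class's quiet blocks and large (∼ `p(g)`) on the class's own young-large-field blocks, so the modulus is
`Σ_b σ_b(τ)` — small for classes with few loud blocks, which are the ones to keep; the others are flagged by COUNT.  THIS FILE states absorption so that all three plug:
* §1 [folklore] ★★★ `core_of_classFactorisation` — THE CLASS FORM: on every GOOD class `τ ∈ T K ∖ Bad K t`, `A ∈ e^{±s_A(K,t,τ)}·m_A(K,t,τ)·R_A(K)` and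
  `B ∈ e^{±s_B(K,t,τ)}·m_B(K,t,τ)·R_B(K)` with CLASS-DEPENDENT moduli bounded on the good classes by `S_A(K)`, `S_B(K)`, class factors `m_A ≥ 0`, CLASS- AND SOURCE-INDEPENDENT scalars
  `R_A, R_B > 0`, and `Core … Bad m_A m_B r` ⇒ `Core … Bad A B (r + (S_A+S_B)∕vol)`, `c_K = c_K(m) + log(R_B K∕R_A K)`; `R_B∕R_A` arbitrary.  ★★ `hybridNE7_of_classFactorisation`: + N20's
  `RelWeightBound … Bad W` for the FLAGGED classes + non-negativity + summable radius ⇒ `HybridNE7 … Bad W 0 0 0 (…)` — the complete law-merge binder list «(Y) young matching +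
  (D) decoupling on the good classes + NE7b on the flagged ones».
* §2 [folklore] PRODUCERS, stated at ONE class (pure finite-sum facts, to be quantified by the user): ★ `classForm_of_fibreFactorisation` (termwise `p(o) ∈ e^{±s}·m·φ(o)` ⇒
  `Σp ∈ e^{±s}·m·Σφ`) · ★★ `classForm_of_relPerturbation` (`A₁ ∈ e^{±s}·mR`, `0 ≤ A₂ ≤ ε·A₁` ⇒ `A₁ + A₂ ∈ e^{±(s + log(1+ε))}·mR`: a relatively rare anomaly of ANY distortion costs
  `log(1+ε) ≤ ε`; a class where it is not relatively small is one to FLAG) · ★★ `prod_sandwich_of_blockwise_sum` (block factors `φ_b ∈ e^{±σ_b}·ψ_b` with BLOCK-DEPENDENT moduli ⇒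
  `∏φ ∈ e^{±Σ_b σ_b}·∏ψ` — the class's bill is the sum over ITS blocks, so quiet blocks cost what they cost and loud blocks are counted) · ★ `modulus_le_of_loudCount` (`≤ N` loud blocks ⇒
  bill `≤ |B|·σq + N·σl`: flag by COUNT, keep `σq + (N_K∕vol)·σl` summable) · ★★ `classForm_of_edgeKernel`
  (`Σ_o a(o)·P(o)·Q` with `a ≥ 0`, `Q ≥ 0`, `P(o) ∈ e^{±σ}·P̄` ⇒ `∈ e^{±σ}·(P̄Q)·Σa`: a causal law whose old-dependence passes through ONE edge kernel costs that kernel's LR-oscillation;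
  deeper window levels ride in the class factor) · and the quantified showcase ★ `core_of_edgeKernels` (two causal runs with Markov edges, young factors `Core`-matched ⇒ `Core` for
  the class sums at radius `r + (S_A+S_B)∕vol`, old laws arbitrary).
* §3 [folklore] ★ `core_cross_of_core` — WHAT IS NECESSARY: `Core … A B δ` and `Core … m_A m_B r` force only `Core … (A·m_B) (B·m_A) (δ + r)`, i.e. two-run RELATIVE homogeneity of
  the effective old scalars; §1's one-run factorisations are the tractable SUFFICIENT road, not forced.
READINGS (located; nothing proposed).  (i) At a window key stub 2's N19′ ∧ N20 pair reads: FLAG (N20 pays, summably) the classes with a pending old region OR too many loud young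
blocks; on the rest pay (Y) + `Σ_{quiet b} σ_b + (#loud b)·σ_loud + log(1+ε_K)` per class, i.e. per unit volume a quiet-block modulus + (loud-block density × `p(g)`-size modulus) +
`ε_K`, summably in `K` — one-run ∕ young-only letters; the old two-run discrepancy is never paid.  (ii) Flagging is decided by class-uniformity of the anomaly's RELATIVE MASS and by the
COUNT of loud blocks, not by distortion.  (iii) Nothing here is Bałaban's; whether [III] §2–3 ∕ [LF-II] (1.80) deliver these letters for d = 4 is unprinted and unproved.

HONEST FRAMING.  Finite-sum ∕ elementary real arithmetic [folklore] over the tree's SHAPES (`Core`, `RelWeightBound`, `HybridNE7`); class factors, scalars, perturbations, blocks,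
kernels occur as HYPOTHESES only; nothing of Bałaban's is asserted or instantiated; no estimate of the programme is proved.  NE7 ∕ NE7b NOT PRINTED as two-run statements for d = 4 ∕
NOT proved; N19 ∕ N20 NOT discharged; K3⁷ OPEN, not claimed, v5 untouched; counts UNMOVED (typed 28∕28 · discharged 5∕27, A 5∕28).  Everything below is PROVED (0 `sorry`, 0 named
facts, standard axioms); no decl carries a cite tag.  One finite four-torus programme at fixed ε — NOT ℝ⁴, NOT infinite volume, NOT OS, NOT a mass gap, NOT the Clay problem (R4 closes
the conditional finite-𝕋⁴ rung `BalabanLadder.UV` only).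
-/

noncomputable section

open Finset
open scoped BigOperators

namespace Summit.QuantumFields.YangMills.BalabanUVNodes.N19RekeyingAbsorptionClassForm

open Summit.QuantumFields.BalabanUV.T4Continuum.Spine.NE7 (Core)
open Literature.MathematicalPhysics.QuantumFieldTheory.Balaban1983to89
open T4WeightBudget (RelWeightBound)
open T4MatchingAssembly (HybridNE7 hybridNE7_noShell)
open Summit.QuantumFields.YangMills.BalabanUVNodes.N19RekeyingAscent (sandwich_sum)
open Summit.QuantumFields.YangMills.BalabanUVNodes.N19RekeyingAbsorption (chain_lower chain_upper)

variable {ι : Type*} [DecidableEq ι] {l₀ vol : ℝ} {T : ℕ → Finset ι} {Bad : ℕ → ℝ → Finset ι}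
  {A B : ℕ → ℝ → ι → ℝ} {mA mB sA sB : ℕ → ℝ → ι → ℝ} {RA RB SA SB r W : ℕ → ℝ}

/-! ## §1 The class form of absorption, off the flagged classes, class-dependent moduli [folklore] -/

/-- **★★★ ABSORPTION, CLASS FORM** [folklore].  On every GOOD class `τ ∈ T K ∖ Bad K t`: run A's class weight `A K t τ ∈ e^{±s_A K t τ}·m_A K t τ·R_A K`, run B's
`B K t τ ∈ e^{±s_B K t τ}·m_B K t τ·R_B K`, the CLASS-DEPENDENT moduli bounded on the good classes (`s_A ≤ S_A K`, `s_B ≤ S_B K`), class factors `m_A ≥ 0`, CLASS- AND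
SOURCE-INDEPENDENT scalars `R_A K, R_B K > 0`, and `Core l₀ vol T Bad m_A m_B r` ⇒ `Core l₀ vol T Bad A B (r + (S_A + S_B)∕vol)` (`0 < vol`).  The scalars' ratio `R_B∕R_A` — the
summed-out structure's two-run discrepancy — is arbitrary and sits in `c_K = c_K(m) + log(R_B K ∕ R_A K)`.  Nothing is asked on the flagged classes. -/
theorem core_of_classFactorisation (hvol : 0 < vol)
    (hA : ∀ (K : ℕ) (t : ℝ), |t| ≤ l₀ → ∀ τ ∈ T K \ Bad K t,
      Real.exp (-sA K t τ) * (mA K t τ * RA K) ≤ A K t τ ∧ A K t τ ≤ Real.exp (sA K t τ) * (mA K t τ * RA K))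
    (hB : ∀ (K : ℕ) (t : ℝ), |t| ≤ l₀ → ∀ τ ∈ T K \ Bad K t,
      Real.exp (-sB K t τ) * (mB K t τ * RB K) ≤ B K t τ ∧ B K t τ ≤ Real.exp (sB K t τ) * (mB K t τ * RB K))
    (hS : ∀ (K : ℕ) (t : ℝ), |t| ≤ l₀ → ∀ τ ∈ T K \ Bad K t, sA K t τ ≤ SA K ∧ sB K t τ ≤ SB K)
    (hmA : ∀ (K : ℕ) (t : ℝ), |t| ≤ l₀ → ∀ τ ∈ T K \ Bad K t, 0 ≤ mA K t τ)
    (hRA : ∀ K, 0 < RA K) (hRB : ∀ K, 0 < RB K) (hm : Core l₀ vol T Bad mA mB r) :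
    Core l₀ vol T Bad A B (fun K => r K + (SA K + SB K) / vol) := by
  intro K
  obtain ⟨c₁, hc₁⟩ := hm K
  set C : ℝ := Real.log (RB K / RA K) with hC
  have hCexp : Real.exp C * RA K = RB K := by
    rw [hC, Real.exp_log (div_pos (hRB K) (hRA K)), div_mul_cancel₀ _ (hRA K).ne']
  refine ⟨c₁ + C, fun t ht τ hτ => ?_⟩
  obtain ⟨hA₁, hA₂⟩ := hA K t ht τ hτ
  obtain ⟨hB₁, hB₂⟩ := hB K t ht τ hτ
  obtain ⟨hm₁, hm₂⟩ := hc₁ t ht τ hτ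
  obtain ⟨hsA, hsB⟩ := hS K t ht τ hτ
  have hmA0 := hmA K t ht τ hτ
  have hA0 : 0 ≤ A K t τ := (mul_nonneg (Real.exp_pos _).le (mul_nonneg hmA0 (hRA K).le)).trans hA₁
  have hsum : vol * ((SA K + SB K) / vol) = SA K + SB K := mul_div_cancel₀ _ hvol.ne'
  constructor
  · have h := chain_lower hmA0 (hRB K).le hA₂ hB₁ hm₁ hCexp.le
    calc Real.exp (c₁ + C - vol * (r K + (SA K + SB K) / vol)) * A K t τ
        ≤ Real.exp (-sB K t τ + (c₁ - vol * r K) + C - sA K t τ) * A K t τ :=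
          mul_le_mul_of_nonneg_right (Real.exp_le_exp.mpr (by rw [mul_add, hsum]; linarith)) hA0
      _ ≤ B K t τ := h
  · have h := chain_upper hmA0 (hRB K).le hA₁ hB₂ hm₂ hCexp.ge
    calc B K t τ ≤ Real.exp (sB K t τ + (c₁ + vol * r K) + C + sA K t τ) * A K t τ := h
      _ ≤ Real.exp (c₁ + C + vol * (r K + (SA K + SB K) / vol)) * A K t τ :=
          mul_le_mul_of_nonneg_right (Real.exp_le_exp.mpr (by rw [mul_add, hsum]; linarith)) hA0

/-- **★★ THE COMPLETE LAW-MERGE BINDER LIST** [folklore]: §1's class form on the GOOD classes + N20's `RelWeightBound l₀ T A B Bad W` for the FLAGGED ones + non-negative class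
weights + a summable radius ⇒ `HybridNE7 l₀ vol T A B Bad W 0 0 0 (r + (S_A+S_B)∕vol)` (zero shells; `T4MatchingAssembly.hybridNE7_noShell` BY NAME).  Reading: «(Y) young matching of
the class factors + (D) decoupling on the good classes + NE7b on the flagged classes» — the old two-run discrepancy `R_B∕R_A` is never paid. -/
theorem hybridNE7_of_classFactorisation (hvol : 0 < vol)
    (hA : ∀ (K : ℕ) (t : ℝ), |t| ≤ l₀ → ∀ τ ∈ T K \ Bad K t,
      Real.exp (-sA K t τ) * (mA K t τ * RA K) ≤ A K t τ ∧ A K t τ ≤ Real.exp (sA K t τ) * (mA K t τ * RA K))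
    (hB : ∀ (K : ℕ) (t : ℝ), |t| ≤ l₀ → ∀ τ ∈ T K \ Bad K t,
      Real.exp (-sB K t τ) * (mB K t τ * RB K) ≤ B K t τ ∧ B K t τ ≤ Real.exp (sB K t τ) * (mB K t τ * RB K))
    (hS : ∀ (K : ℕ) (t : ℝ), |t| ≤ l₀ → ∀ τ ∈ T K \ Bad K t, sA K t τ ≤ SA K ∧ sB K t τ ≤ SB K)
    (hmA : ∀ (K : ℕ) (t : ℝ), |t| ≤ l₀ → ∀ τ ∈ T K \ Bad K t, 0 ≤ mA K t τ)
    (hRA : ∀ K, 0 < RA K) (hRB : ∀ K, 0 < RB K) (hm : Core l₀ vol T Bad mA mB r)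
    (hW : RelWeightBound l₀ T A B Bad W)
    (hA0 : ∀ (K : ℕ) (t : ℝ), |t| ≤ l₀ → ∀ τ ∈ T K, 0 ≤ A K t τ) (hB0 : ∀ (K : ℕ) (t : ℝ), |t| ≤ l₀ → ∀ τ ∈ T K, 0 ≤ B K t τ)
    (hrad : Summable fun K => r K + (SA K + SB K) / vol) :
    HybridNE7 l₀ vol T A B Bad W (fun _ _ _ => 0) (fun _ _ _ => 0) (fun _ => 0) (fun K => r K + (SA K + SB K) / vol) :=
  hybridNE7_noShell hW hA0 hB0 hrad (core_of_classFactorisation hvol hA hB hS hmA hRA hRB hm)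

/-! ## §2 Producers of the class form, stated at one class [folklore] -/

section Producers
variable {ω β : Type*}

/-- **★ FIBREWISE FACTORISATION ⇒ CLASS FORM** [folklore] (p610409 §3's hypothesis at one class): `p(o) ∈ e^{±s}·m·φ(o)` for `o ∈ O` ⇒ `Σ_O p ∈ e^{±s}·m·Σ_O φ`. -/
theorem classForm_of_fibreFactorisation {O : Finset ω} {p φ : ω → ℝ} {m s : ℝ}
    (hfac : ∀ o ∈ O, Real.exp (-s) * (m * φ o) ≤ p o ∧ p o ≤ Real.exp s * (m * φ o)) :
    Real.exp (-s) * (m * ∑ o ∈ O, φ o) ≤ ∑ o ∈ O, p o ∧ ∑ o ∈ O, p o ≤ Real.exp s * (m * ∑ o ∈ O, φ o) := by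
  have h := sandwich_sum (F := O) (p := fun o => m * φ o) (q := p) hfac
  rwa [← Finset.mul_sum] at h

/-- **★★ A RELATIVELY RARE UNFLAGGED PERTURBATION OF ANY DISTORTION IS ABSORBED** [folklore].  Main part `A₁ ∈ e^{±s}·(m·R)` (`m ≥ 0`, `R > 0`) plus an anomalous part
`0 ≤ A₂ ≤ ε·A₁` (relative mass `ε ≥ 0`, distortion otherwise arbitrary) ⇒ `A₁ + A₂ ∈ e^{±(s + log(1+ε))}·(m·R)`.  (Healed-but-atypical old regions inside a good class cost
`log(1+ε) ≤ ε`; a class in which the anomaly is NOT relatively small is one to flag.) -/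
theorem classForm_of_relPerturbation {A₁ A₂ m R s ε : ℝ} (hm : 0 ≤ m) (hR : 0 < R) (hε : 0 ≤ ε)
    (h₁ : Real.exp (-s) * (m * R) ≤ A₁ ∧ A₁ ≤ Real.exp s * (m * R)) (h₂ : 0 ≤ A₂ ∧ A₂ ≤ ε * A₁) :
    Real.exp (-(s + Real.log (1 + ε))) * (m * R) ≤ A₁ + A₂ ∧ A₁ + A₂ ≤ Real.exp (s + Real.log (1 + ε)) * (m * R) := by
  obtain ⟨hl, hu⟩ := h₁
  obtain ⟨h20, h2ε⟩ := h₂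
  have hε1 : 0 < 1 + ε := by linarith
  have hmR : 0 ≤ m * R := mul_nonneg hm hR.le
  constructor
  · have hle : Real.exp (-(s + Real.log (1 + ε))) ≤ Real.exp (-s) :=
      Real.exp_le_exp.mpr (by linarith [Real.log_nonneg (show (1 : ℝ) ≤ 1 + ε by linarith)])
    calc Real.exp (-(s + Real.log (1 + ε))) * (m * R) ≤ Real.exp (-s) * (m * R) := mul_le_mul_of_nonneg_right hle hmR
      _ ≤ A₁ := hl
      _ ≤ A₁ + A₂ := le_add_of_nonneg_right h20
  · have hA₁0 : 0 ≤ A₁ := (mul_nonneg (Real.exp_pos _).le hmR).trans hl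
    calc A₁ + A₂ ≤ (1 + ε) * A₁ := by nlinarith
      _ ≤ (1 + ε) * (Real.exp s * (m * R)) := mul_le_mul_of_nonneg_left hu hε1.le
      _ = Real.exp (s + Real.log (1 + ε)) * (m * R) := by rw [Real.exp_add, Real.exp_log hε1]; ring

/-- **★★ BLOCKWISE FACTORS WITH BLOCK-DEPENDENT MODULI** [folklore] (refines p610409 `prod_sandwich_of_blockwise`): `φ b ∈ e^{±σ b}·ψ b`, `ψ b ≥ 0` for `b ∈ B` ⇒
`∏_B φ ∈ e^{±Σ_B σ}·∏_B ψ`.  The bill of a class is the sum over ITS blocks of their own moduli — quiet blocks (no young large field there: edge coupling tiny) cost little, loud blocks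
(the class's young large-field blocks: coupling of size ∼ `p(g)`) are COUNTED; classes with too many loud blocks are the ones to flag. -/
theorem prod_sandwich_of_blockwise_sum {B : Finset β} {φ ψ σ : β → ℝ} (hψ : ∀ b ∈ B, 0 ≤ ψ b)
    (h : ∀ b ∈ B, Real.exp (-σ b) * ψ b ≤ φ b ∧ φ b ≤ Real.exp (σ b) * ψ b) :
    Real.exp (-∑ b ∈ B, σ b) * ∏ b ∈ B, ψ b ≤ ∏ b ∈ B, φ b ∧ ∏ b ∈ B, φ b ≤ Real.exp (∑ b ∈ B, σ b) * ∏ b ∈ B, ψ b := by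
  have hφ : ∀ b ∈ B, 0 ≤ φ b := fun b hb => (mul_nonneg (Real.exp_pos _).le (hψ b hb)).trans (h b hb).1
  constructor
  · calc Real.exp (-∑ b ∈ B, σ b) * ∏ b ∈ B, ψ b = ∏ b ∈ B, Real.exp (-σ b) * ψ b := by
          rw [Finset.prod_mul_distrib, ← Real.exp_sum, Finset.sum_neg_distrib]
      _ ≤ ∏ b ∈ B, φ b := Finset.prod_le_prod (fun b hb => mul_nonneg (Real.exp_pos _).le (hψ b hb)) fun b hb => (h b hb).1
  · calc ∏ b ∈ B, φ b ≤ ∏ b ∈ B, Real.exp (σ b) * ψ b := Finset.prod_le_prod hφ fun b hb => (h b hb).2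
      _ = Real.exp (∑ b ∈ B, σ b) * ∏ b ∈ B, ψ b := by rw [Finset.prod_mul_distrib, ← Real.exp_sum]

/-- **★ THE LOUD-BLOCK COUNT BOUNDS THE CLASS's MODULUS** [folklore].  If each of the `|B|` blocks has modulus either `σq` (quiet) or at most `σl` (loud, `σq ≤ σl`), and the class has at
most `N` loud blocks, then its total modulus is `≤ |B|·σq + N·σl`.  With `|B| ≍ vol` the per-unit-volume bill of an unflagged class is `σq + (N∕vol)·σl`: flag the classes with more than
`N_K` loud (young-large-field) blocks — N20 pays their count-tail weight — and keep `σq(K) + (N_K∕vol)·σl(K)` summable in `K` (a loud modulus of size `∼ p(g_K)` forces the allowed loud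
DENSITY `N_K∕vol` to beat it: the window-width ∕ fraction condition of the `window-key-core` card in another guise). -/
theorem modulus_le_of_loudCount {B : Finset β} {σ : β → ℝ} {σq σl : ℝ} {N : ℕ} (loud : Finset β) (hloud : loud ⊆ B)
    (hq : 0 ≤ σq) (hql : σq ≤ σl) (hquiet : ∀ b ∈ B, b ∉ loud → σ b ≤ σq) (hl : ∀ b ∈ loud, σ b ≤ σl) (hN : loud.card ≤ N) :
    ∑ b ∈ B, σ b ≤ B.card * σq + N * σl := by
  classical
  have hsplit : ∑ b ∈ B, σ b = ∑ b ∈ loud, σ b + ∑ b ∈ B \ loud, σ b := by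
    rw [← Finset.sum_union (Finset.disjoint_sdiff), Finset.union_sdiff_of_subset hloud]
  have h1 : ∑ b ∈ loud, σ b ≤ loud.card * σl := by
    have := Finset.sum_le_sum hl
    rwa [Finset.sum_const, nsmul_eq_mul] at this
  have h2 : ∑ b ∈ B \ loud, σ b ≤ (B \ loud).card * σq := by
    have := Finset.sum_le_sum fun b hb => hquiet b (Finset.mem_sdiff.mp hb).1 (Finset.mem_sdiff.mp hb).2
    rwa [Finset.sum_const, nsmul_eq_mul] at this
  have h3 : ((B \ loud).card : ℝ) ≤ B.card := by exact_mod_cast Finset.card_le_card Finset.sdiff_subset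
  have h4 : (loud.card : ℝ) ≤ N := by exact_mod_cast hN
  have hσl : 0 ≤ σl := hq.trans hql
  calc ∑ b ∈ B, σ b = ∑ b ∈ loud, σ b + ∑ b ∈ B \ loud, σ b := hsplit
    _ ≤ loud.card * σl + (B \ loud).card * σq := add_le_add h1 h2
    _ ≤ N * σl + B.card * σq := add_le_add (mul_le_mul_of_nonneg_right h4 hσl) (mul_le_mul_of_nonneg_right h3 hq)
    _ = B.card * σq + N * σl := by ring

/-- **★★ A CAUSAL LAW THROUGH ONE MARKOV EDGE ⇒ CLASS FORM** [folklore], at one class: `Σ_O a(o)·(P(o)·Q)` — old law `a ≥ 0`, edge kernel value `P(o)` at the class's first window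
level, old-independent continuation `Q ≥ 0` — with `P(o) ∈ e^{±σ}·P̄` for `o ∈ O` ⇒ `∈ e^{±σ}·(P̄·Q)·Σ_O a`: the decoupling letter costs the LR-oscillation of the ONE step into the
window; the deeper window levels (inside `Q`) are free. -/
theorem classForm_of_edgeKernel {O : Finset ω} {a P : ω → ℝ} {Pbar Q σ : ℝ}
    (ha : ∀ o ∈ O, 0 ≤ a o) (hQ : 0 ≤ Q) (hP : ∀ o ∈ O, Real.exp (-σ) * Pbar ≤ P o ∧ P o ≤ Real.exp σ * Pbar) :
    Real.exp (-σ) * ((Pbar * Q) * ∑ o ∈ O, a o) ≤ ∑ o ∈ O, a o * (P o * Q) ∧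
      ∑ o ∈ O, a o * (P o * Q) ≤ Real.exp σ * ((Pbar * Q) * ∑ o ∈ O, a o) := by
  have h := sandwich_sum (F := O) (p := fun o => (Pbar * Q) * a o) (q := fun o => a o * (P o * Q)) (lo := Real.exp (-σ)) (hi := Real.exp σ)
    fun o ho => by
      obtain ⟨hlo, hhi⟩ := hP o ho
      have hw : 0 ≤ a o * Q := mul_nonneg (ha o ho) hQ
      constructor
      · calc Real.exp (-σ) * (Pbar * Q * a o) = (a o * Q) * (Real.exp (-σ) * Pbar) := by ring
          _ ≤ (a o * Q) * P o := mul_le_mul_of_nonneg_left hlo hw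
          _ = a o * (P o * Q) := by ring
      · calc a o * (P o * Q) = (a o * Q) * P o := by ring
          _ ≤ (a o * Q) * (Real.exp σ * Pbar) := mul_le_mul_of_nonneg_left hhi hw
          _ = Real.exp σ * (Pbar * Q * a o) := by ring
  rwa [← Finset.mul_sum] at h

variable {O : ℕ → Finset ω}

/-- **★ THE WINDOW-KEY `Core` FOR TWO CAUSAL RUNS WITH MARKOV EDGES** [folklore] (the quantified showcase of `classForm_of_edgeKernel` + §1): on the good classes run A is
`Σ_o a·P_A(o, e τ)·Q_A(τ)` and run B `Σ_o b·P_B(o, e τ)·Q_B(τ)` (old laws `a, b ≥ 0` of positive mass; `e K τ` = the class's first window level; continuations `Q ≥ 0`), the edge kernels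
within `e^{±σ_A(K, e τ)}`, `e^{±σ_B(K, e τ)}` of old-independent `P̄_A`, `P̄_B` — CLASS-DEPENDENT moduli bounded by `S_A K`, `S_B K` on the good classes — `P̄_A·Q_A ≥ 0`, and the young
factors matched, `Core … Bad (P̄_A(e τ)·Q_A τ) (P̄_B(e τ)·Q_B τ) r` ⇒ `Core … Bad A B (r + (S_A + S_B)∕vol)`.  The old laws — and their two-run discrepancy — are otherwise arbitrary. -/
theorem core_of_edgeKernels {ξ : Type*} {a b : ℕ → ω → ℝ} {e : ℕ → ι → ξ} {PA PB : ℕ → ω → ξ → ℝ} {PbarA PbarB : ℕ → ξ → ℝ}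
    {QA QB : ℕ → ℝ → ι → ℝ} {σA σB : ℕ → ξ → ℝ} (hvol : 0 < vol)
    (ha : ∀ K, ∀ o ∈ O K, 0 ≤ a K o) (hb : ∀ K, ∀ o ∈ O K, 0 ≤ b K o)
    (hapos : ∀ K, 0 < ∑ o ∈ O K, a K o) (hbpos : ∀ K, 0 < ∑ o ∈ O K, b K o)
    (hQA : ∀ (K : ℕ) (t : ℝ), |t| ≤ l₀ → ∀ τ ∈ T K \ Bad K t, 0 ≤ QA K t τ)
    (hQB : ∀ (K : ℕ) (t : ℝ), |t| ≤ l₀ → ∀ τ ∈ T K \ Bad K t, 0 ≤ QB K t τ)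
    (hmA : ∀ (K : ℕ) (t : ℝ), |t| ≤ l₀ → ∀ τ ∈ T K \ Bad K t, 0 ≤ PbarA K (e K τ) * QA K t τ)
    (hPA : ∀ K, ∀ o ∈ O K, ∀ x : ξ, Real.exp (-σA K x) * PbarA K x ≤ PA K o x ∧ PA K o x ≤ Real.exp (σA K x) * PbarA K x)
    (hPB : ∀ K, ∀ o ∈ O K, ∀ x : ξ, Real.exp (-σB K x) * PbarB K x ≤ PB K o x ∧ PB K o x ≤ Real.exp (σB K x) * PbarB K x)
    (hS : ∀ (K : ℕ) (t : ℝ), |t| ≤ l₀ → ∀ τ ∈ T K \ Bad K t, σA K (e K τ) ≤ SA K ∧ σB K (e K τ) ≤ SB K)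
    (hA : ∀ (K : ℕ) (t : ℝ), |t| ≤ l₀ → ∀ τ ∈ T K \ Bad K t, A K t τ = ∑ o ∈ O K, a K o * (PA K o (e K τ) * QA K t τ))
    (hB : ∀ (K : ℕ) (t : ℝ), |t| ≤ l₀ → ∀ τ ∈ T K \ Bad K t, B K t τ = ∑ o ∈ O K, b K o * (PB K o (e K τ) * QB K t τ))
    (hyoung : Core l₀ vol T Bad (fun K t τ => PbarA K (e K τ) * QA K t τ) (fun K t τ => PbarB K (e K τ) * QB K t τ) r) :
    Core l₀ vol T Bad A B (fun K => r K + (SA K + SB K) / vol) := by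
  refine core_of_classFactorisation (mA := fun K t τ => PbarA K (e K τ) * QA K t τ) (mB := fun K t τ => PbarB K (e K τ) * QB K t τ)
    (sA := fun K _ τ => σA K (e K τ)) (sB := fun K _ τ => σB K (e K τ)) (RA := fun K => ∑ o ∈ O K, a K o) (RB := fun K => ∑ o ∈ O K, b K o) hvol
    (fun K t ht τ hτ => ?_) (fun K t ht τ hτ => ?_) hS hmA hapos hbpos hyoung
  · rw [hA K t ht τ hτ]
    exact classForm_of_edgeKernel (ha K) (hQA K t ht τ hτ) fun o ho => hPA K o ho (e K τ)
  · rw [hB K t ht τ hτ]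
    exact classForm_of_edgeKernel (hb K) (hQB K t ht τ hτ) fun o ho => hPB K o ho (e K τ)

end Producers

/-! ## §3 What is NECESSARY: only RELATIVE homogeneity of the old scalars [folklore] -/

section Necessity
variable {δ : ℕ → ℝ}

/-- **★ THE CONVERSE BOOKKEEPING** [folklore].  §1 asks each run SEPARATELY to factorise with a class-independent old scalar — a sufficient, one-run pair of letters.  What `Core`
at the coarse key actually FORCES is only two-run RELATIVE homogeneity: if the class sums match (`Core … Bad A B δ`) and the young class factors match (`Core … Bad m_A m_B r`), with
`A, m_A ≥ 0` on the good classes, then the cross products `A·m_B` and `B·m_A` match modulo constants at radius `δ + r` — i.e. the effective old-scalar ratio `(B∕m_B)∕(A∕m_A)` is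
class- and source-homogeneous up to `e^{±vol(δ_K + r_K)}`.  (So a two-run proof may pay less than (D) for each run; the one-run form is the tractable SUFFICIENT road.) -/
theorem core_cross_of_core (hAB : Core l₀ vol T Bad A B δ) (hm : Core l₀ vol T Bad mA mB r)
    (hA0 : ∀ (K : ℕ) (t : ℝ), |t| ≤ l₀ → ∀ τ ∈ T K \ Bad K t, 0 ≤ A K t τ)
    (hmA : ∀ (K : ℕ) (t : ℝ), |t| ≤ l₀ → ∀ τ ∈ T K \ Bad K t, 0 ≤ mA K t τ) :
    Core l₀ vol T Bad (fun K t τ => A K t τ * mB K t τ) (fun K t τ => B K t τ * mA K t τ) (fun K => δ K + r K) := by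
  intro K
  obtain ⟨c, hc⟩ := hAB K
  obtain ⟨c', hc'⟩ := hm K
  refine ⟨c - c', fun t ht τ hτ => ?_⟩
  obtain ⟨h₁, h₂⟩ := hc t ht τ hτ
  obtain ⟨h₃, h₄⟩ := hc' t ht τ hτ
  have hA := hA0 K t ht τ hτ
  have hm0 := hmA K t ht τ hτ
  have e₁ : Real.exp (c - c' - vol * (δ K + r K)) = Real.exp (c - vol * δ K) * Real.exp (-(c' + vol * r K)) := by
    rw [← Real.exp_add]; congr 1; ring
  have e₂ : Real.exp (c - c' + vol * (δ K + r K)) = Real.exp (c + vol * δ K) * Real.exp (-(c' - vol * r K)) := by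
    rw [← Real.exp_add]; congr 1; ring
  constructor
  · -- `e^{c−c′−v(δ+r)}·(A·m_B) ≤ e^{c−vδ}A · e^{−(c′+vr)}·e^{c′+vr} m_A = e^{c−vδ}A·m_A ≤ B·m_A`
    have hmB : Real.exp (-(c' + vol * r K)) * mB K t τ ≤ mA K t τ := by
      have := mul_le_mul_of_nonneg_left h₄ (Real.exp_pos (-(c' + vol * r K))).le
      rwa [← mul_assoc, ← Real.exp_add, neg_add_cancel, Real.exp_zero, one_mul] at this
    calc Real.exp (c - c' - vol * (δ K + r K)) * (A K t τ * mB K t τ)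
        = (Real.exp (c - vol * δ K) * A K t τ) * (Real.exp (-(c' + vol * r K)) * mB K t τ) := by rw [e₁]; ring
      _ ≤ (Real.exp (c - vol * δ K) * A K t τ) * mA K t τ := mul_le_mul_of_nonneg_left hmB (mul_nonneg (Real.exp_pos _).le hA)
      _ ≤ B K t τ * mA K t τ := mul_le_mul_of_nonneg_right h₁ hm0
  · have hmB : mA K t τ ≤ Real.exp (-(c' - vol * r K)) * mB K t τ := by
      have := mul_le_mul_of_nonneg_left h₃ (Real.exp_pos (-(c' - vol * r K))).le
      rwa [← mul_assoc, ← Real.exp_add, neg_add_cancel, Real.exp_zero, one_mul] at this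
    have hB0 : 0 ≤ B K t τ := (mul_nonneg (Real.exp_pos _).le hA).trans h₁
    calc B K t τ * mA K t τ ≤ B K t τ * (Real.exp (-(c' - vol * r K)) * mB K t τ) := mul_le_mul_of_nonneg_left hmB hB0
      _ ≤ (Real.exp (c + vol * δ K) * A K t τ) * (Real.exp (-(c' - vol * r K)) * mB K t τ) :=
          mul_le_mul_of_nonneg_right h₂ (hm0.trans hmB)
      _ = Real.exp (c - c' + vol * (δ K + r K)) * (A K t τ * mB K t τ) := by rw [e₂]; ring

end Necessity

/-! ## §3b (v1.1, append-only) The characterisation: given matched young factors, coarse `Core` ⟺ relative homogeneity of the old scalars [folklore] -/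

section Characterisation
variable {δ : ℕ → ℝ}

/-- **★ THE CONVERSE OF `core_cross_of_core`** [folklore]: if the cross products match modulo constants (`Core … Bad (A·m_B) (B·m_A) δ`) and the young class factors match
(`Core … Bad m_A m_B r`), with `m_A > 0` and `A ≥ 0` on the good classes, then the class sums match: `Core … Bad A B (δ + r)` (divide by `m_A`). -/
theorem core_of_core_cross (hx : Core l₀ vol T Bad (fun K t τ => A K t τ * mB K t τ) (fun K t τ => B K t τ * mA K t τ) δ) (hm : Core l₀ vol T Bad mA mB r)
    (hA0 : ∀ (K : ℕ) (t : ℝ), |t| ≤ l₀ → ∀ τ ∈ T K \ Bad K t, 0 ≤ A K t τ)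
    (hmA : ∀ (K : ℕ) (t : ℝ), |t| ≤ l₀ → ∀ τ ∈ T K \ Bad K t, 0 < mA K t τ) :
    Core l₀ vol T Bad A B (fun K => δ K + r K) := by
  intro K
  obtain ⟨c, hc⟩ := hx K
  obtain ⟨c', hc'⟩ := hm K
  refine ⟨c + c', fun t ht τ hτ => ?_⟩
  obtain ⟨h₁, h₂⟩ := hc t ht τ hτ
  obtain ⟨h₃, h₄⟩ := hc' t ht τ hτ
  have hA := hA0 K t ht τ hτ
  have hm0 := hmA K t ht τ hτ
  have e₁ : Real.exp (c + c' - vol * (δ K + r K)) = Real.exp (c - vol * δ K) * Real.exp (c' - vol * r K) := by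
    rw [← Real.exp_add]; congr 1; ring
  have e₂ : Real.exp (c + c' + vol * (δ K + r K)) = Real.exp (c + vol * δ K) * Real.exp (c' + vol * r K) := by
    rw [← Real.exp_add]; congr 1; ring
  constructor
  · -- `e^{c−vδ}A·(e^{c′−vr} m_A) ≤ e^{c−vδ}A·m_B ≤ B·m_A`, then cancel `m_A > 0`
    have key : (Real.exp (c + c' - vol * (δ K + r K)) * A K t τ) * mA K t τ ≤ B K t τ * mA K t τ :=
      calc (Real.exp (c + c' - vol * (δ K + r K)) * A K t τ) * mA K t τ
          = (Real.exp (c - vol * δ K) * A K t τ) * (Real.exp (c' - vol * r K) * mA K t τ) := by rw [e₁]; ring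
        _ ≤ (Real.exp (c - vol * δ K) * A K t τ) * mB K t τ := mul_le_mul_of_nonneg_left h₃ (mul_nonneg (Real.exp_pos _).le hA)
        _ = Real.exp (c - vol * δ K) * (A K t τ * mB K t τ) := by ring
        _ ≤ B K t τ * mA K t τ := h₁
    exact le_of_mul_le_mul_right key hm0
  · have key : B K t τ * mA K t τ ≤ (Real.exp (c + c' + vol * (δ K + r K)) * A K t τ) * mA K t τ :=
      calc B K t τ * mA K t τ ≤ Real.exp (c + vol * δ K) * (A K t τ * mB K t τ) := h₂
        _ = (Real.exp (c + vol * δ K) * A K t τ) * mB K t τ := by ring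
        _ ≤ (Real.exp (c + vol * δ K) * A K t τ) * (Real.exp (c' + vol * r K) * mA K t τ) := mul_le_mul_of_nonneg_left h₄ (mul_nonneg (Real.exp_pos _).le hA)
        _ = (Real.exp (c + c' + vol * (δ K + r K)) * A K t τ) * mA K t τ := by rw [e₂]; ring
    exact le_of_mul_le_mul_right key hm0

/-- **★★ THE CHARACTERISATION** [folklore].  Given matched young class factors (`Core … Bad m_A m_B r`, `r` summable), `m_A > 0` and `A ≥ 0` on the good classes: the class sums
carry SOME summable `Core` radius IFF the cross products `A·m_B`, `B·m_A` do — i.e. «coarse N19′» ⟺ «two-run RELATIVE homogeneity of the effective old scalars, summably». -/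
theorem coreEdge_iff_coreEdge_cross (hm : Core l₀ vol T Bad mA mB r) (hr : Summable r)
    (hA0 : ∀ (K : ℕ) (t : ℝ), |t| ≤ l₀ → ∀ τ ∈ T K \ Bad K t, 0 ≤ A K t τ)
    (hmA : ∀ (K : ℕ) (t : ℝ), |t| ≤ l₀ → ∀ τ ∈ T K \ Bad K t, 0 < mA K t τ) :
    (∃ δ : ℕ → ℝ, Core l₀ vol T Bad A B δ ∧ Summable δ) ↔
      ∃ δ : ℕ → ℝ, Core l₀ vol T Bad (fun K t τ => A K t τ * mB K t τ) (fun K t τ => B K t τ * mA K t τ) δ ∧ Summable δ := by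
  constructor
  · rintro ⟨δ, hC, hδ⟩
    exact ⟨fun K => δ K + r K, core_cross_of_core hC hm hA0 (fun K t ht τ hτ => (hmA K t ht τ hτ).le), hδ.add hr⟩
  · rintro ⟨δ, hC, hδ⟩
    exact ⟨fun K => δ K + r K, core_of_core_cross hC hm hA0 hmA, hδ.add hr⟩

end Characterisation

/-! ## §3c (v1.1, append-only) Source-dependent old scalars: the RATIO's source-oscillation is what costs [folklore] -/

section SourceDep
variable {RAt RBt : ℕ → ℝ → ℝ} {w : ℕ → ℝ}

/-- **★ THE CLASS FORM WITH SOURCE-DEPENDENT OLD SCALARS** [folklore].  As `core_of_classFactorisation`, but the old scalars `R_A K t`, `R_B K t` may depend on the source `t`; what is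
asked instead is that their RATIO be source-homogeneous modulo one constant per level: `e^{C_K − w_K}·R_A K t ≤ R_B K t ≤ e^{C_K + w_K}·R_A K t` on `|t| ≤ l₀`.  Then
`Core … Bad A B (r + (S_A + S_B + w)∕vol)`: a source-dependence of the summed-out structure's two-run ratio costs its oscillation `w_K`, nothing else. -/
theorem core_of_classFactorisation_sourceDep (hvol : 0 < vol)
    (hA : ∀ (K : ℕ) (t : ℝ), |t| ≤ l₀ → ∀ τ ∈ T K \ Bad K t,
      Real.exp (-sA K t τ) * (mA K t τ * RAt K t) ≤ A K t τ ∧ A K t τ ≤ Real.exp (sA K t τ) * (mA K t τ * RAt K t))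
    (hB : ∀ (K : ℕ) (t : ℝ), |t| ≤ l₀ → ∀ τ ∈ T K \ Bad K t,
      Real.exp (-sB K t τ) * (mB K t τ * RBt K t) ≤ B K t τ ∧ B K t τ ≤ Real.exp (sB K t τ) * (mB K t τ * RBt K t))
    (hS : ∀ (K : ℕ) (t : ℝ), |t| ≤ l₀ → ∀ τ ∈ T K \ Bad K t, sA K t τ ≤ SA K ∧ sB K t τ ≤ SB K)
    (hmA : ∀ (K : ℕ) (t : ℝ), |t| ≤ l₀ → ∀ τ ∈ T K \ Bad K t, 0 ≤ mA K t τ)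
    (hRA : ∀ (K : ℕ) (t : ℝ), |t| ≤ l₀ → 0 < RAt K t) (hRB : ∀ (K : ℕ) (t : ℝ), |t| ≤ l₀ → 0 < RBt K t)
    (hR : ∀ K : ℕ, ∃ C : ℝ, ∀ t : ℝ, |t| ≤ l₀ → Real.exp (C - w K) * RAt K t ≤ RBt K t ∧ RBt K t ≤ Real.exp (C + w K) * RAt K t)
    (hm : Core l₀ vol T Bad mA mB r) :
    Core l₀ vol T Bad A B (fun K => r K + (SA K + SB K + w K) / vol) := by
  intro K
  obtain ⟨c₁, hc₁⟩ := hm K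
  obtain ⟨C, hC⟩ := hR K
  refine ⟨c₁ + C, fun t ht τ hτ => ?_⟩
  obtain ⟨hA₁, hA₂⟩ := hA K t ht τ hτ
  obtain ⟨hB₁, hB₂⟩ := hB K t ht τ hτ
  obtain ⟨hm₁, hm₂⟩ := hc₁ t ht τ hτ
  obtain ⟨hsA, hsB⟩ := hS K t ht τ hτ
  obtain ⟨hR₁, hR₂⟩ := hC t ht
  have hmA0 := hmA K t ht τ hτ
  have hA0 : 0 ≤ A K t τ := (mul_nonneg (Real.exp_pos _).le (mul_nonneg hmA0 (hRA K t ht).le)).trans hA₁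
  have hsum : vol * ((SA K + SB K + w K) / vol) = SA K + SB K + w K := mul_div_cancel₀ _ hvol.ne'
  constructor
  · have h := chain_lower hmA0 (hRB K t ht).le hA₂ hB₁ hm₁ hR₁
    calc Real.exp (c₁ + C - vol * (r K + (SA K + SB K + w K) / vol)) * A K t τ
        ≤ Real.exp (-sB K t τ + (c₁ - vol * r K) + (C - w K) - sA K t τ) * A K t τ :=
          mul_le_mul_of_nonneg_right (Real.exp_le_exp.mpr (by rw [mul_add, hsum]; linarith)) hA0
      _ ≤ B K t τ := h
  · have h := chain_upper hmA0 (hRB K t ht).le hA₁ hB₂ hm₂ hR₂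
    calc B K t τ ≤ Real.exp (sB K t τ + (c₁ + vol * r K) + (C + w K) + sA K t τ) * A K t τ := h
      _ ≤ Real.exp (c₁ + C + vol * (r K + (SA K + SB K + w K) / vol)) * A K t τ :=
          mul_le_mul_of_nonneg_right (Real.exp_le_exp.mpr (by rw [mul_add, hsum]; linarith)) hA0

end SourceDep

end Summit.QuantumFields.YangMills.BalabanUVNodes.N19RekeyingAbsorptionClassForm
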